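import Literature.MathematicalPhysics.QuantumLattice.SchwartzHalfSpaceCutoffA
import Literature.MathematicalPhysics.QuantumLattice.SchwartzTranslationCutoff
import Literature.MathematicalPhysics.AQFT.OSAxiomsSchwinger
import Mathlib.Analysis.Calculus.BumpFunction.FiniteDimension
import HarnessLib

/-!
# Stub `stub_rope` of line `Sketch` (crux `OSLegsAtWeakCouplingC`, stmt-QuantumFields-16207) — helper I:
# compact cutoffs preserving `⁰𝒮`

Helper file for stub `stub_rope` (DefsR3 §4.4 `Statement.stub_rope`).  The reflection-positivity half of the stub
(`RPPos` of the soft limit: E2 on finite tuples of positive-time OFF-DIAGONAL test functions) is proved on the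
lattice for compactly supported tuples and then extended by density; the density step needs compactly supported
approximants that stay in `⁰𝒮` (all derivatives vanish on the coincidence locus).  The bump cutoffs
`x ↦ χ(x/(m+1)) F(x)` of Hörmander I, Lemma 7.1.8 do (Leibniz: `⁰𝒮` is a module over smooth temperate multipliers,
tree `isOffDiagonal_smulLeftCLM`), so we re-run the tree's `exists_tsupport_subset_inter_closedBall_tendsto`
keeping track of the multiplier:
* `exists_smulLeftCLM_cutoff_tendsto` — cutoffs `u m = ψₘ • f` with `ψₘ` temperate, `tsupport (u m) ⊆ tsupport f ∩ B(0, 2(m+1))`,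
  `u m → f` in `𝓢`;
* `exists_offDiagonal_cutoff_tendsto` — for `F ∈ ⁰𝒮((ℝ-normed E)ⁿ)` the cutoffs are again in `⁰𝒮`.
-/

open scoped SchwartzMap Topology ContDiff
open Filter Set Metric

namespace Summit.QuantumFields.YangMills.Theorems.OSLegsFromFemtoAndGap

section Cutoff

variable {E F : Type*} [NormedAddCommGroup E] [NormedSpace ℝ E] [NormedAddCommGroup F] [NormedSpace ℝ F]
  [FiniteDimensional ℝ E]

-- adapted from `Literature.MathematicalPhysics.QuantumLattice.exists_tsupport_subset_inter_closedBall_tendsto`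
/-- **Compact bump cutoffs converge in `𝓢(E, F)`, with the multiplier exposed** (`E` finite dimensional): for every
`f ∈ 𝓢(E, F)` there are temperate smooth multipliers `ψ m` such that `u m := ψ m • f` satisfies
`tsupport (u m) ⊆ tsupport f ∩ closedBall 0 (2 (m + 1))` and `u m → f` in the Schwartz topology
(Hörmander I, Lemma 7.1.8). -/
theorem exists_smulLeftCLM_cutoff_tendsto (f : 𝓢(E, F)) :
    ∃ ψ : ℕ → E → ℝ, (∀ m, (ψ m).HasTemperateGrowth) ∧
      (∀ m : ℕ, tsupport (SchwartzMap.smulLeftCLM F (ψ m) f : E → F) ⊆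
        tsupport (f : E → F) ∩ closedBall (0 : E) (2 * ((m : ℝ) + 1))) ∧
        Tendsto (fun m => SchwartzMap.smulLeftCLM F (ψ m) f) atTop (𝓝 f) := by
  let χ : ContDiffBump (0 : E) := ⟨1, 2, one_pos, one_lt_two⟩
  have hR : ∀ m : ℕ, (0 : ℝ) < m + 1 := fun m => by positivity
  let L : ℕ → E →L[ℝ] E := fun m => ((m : ℝ) + 1)⁻¹ • ContinuousLinearMap.id ℝ E
  let χR : ℕ → E → ℝ := fun m => (χ : E → ℝ) ∘ L m
  have hχ_smooth : ContDiff ℝ ∞ (χ : E → ℝ) := χ.contDiff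
  have hχR_smooth : ∀ m, ContDiff ℝ ∞ (χR m) := fun m => hχ_smooth.comp (L m).contDiff
  have hχR_zero : ∀ (m : ℕ) (x : E), 2 * ((m : ℝ) + 1) < ‖x‖ → χR m x = 0 := by
    intro m x hx
    have hx' : ((m : ℝ) + 1)⁻¹ • x ∉ Function.support (χ : E → ℝ) := by
      rw [χ.support_eq, mem_ball_zero_iff, norm_smul, norm_inv, Real.norm_of_nonneg (hR m).le,
        not_lt, le_inv_mul_iff₀ (hR m)]
      change ((m : ℝ) + 1) * 2 ≤ ‖x‖
      linarith
    rw [Function.mem_support, not_not] at hx'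
    exact hx'
  have hχR_one : ∀ (m : ℕ) (x : E), ‖x‖ ≤ (m : ℝ) + 1 → χR m x = 1 := by
    intro m x hx
    apply χ.one_of_mem_closedBall
    change ((m : ℝ) + 1)⁻¹ • x ∈ closedBall (0 : E) 1
    rw [mem_closedBall_zero_iff, norm_smul, norm_inv, Real.norm_of_nonneg (hR m).le,
      inv_mul_le_iff₀ (hR m), mul_one]
    exact hx
  have hχR_supp : ∀ m, HasCompactSupport (χR m) := fun m =>
    HasCompactSupport.intro (isCompact_closedBall (0 : E) (2 * ((m : ℝ) + 1))) fun x hx =>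
      hχR_zero m x (by simpa [mem_closedBall_zero_iff] using hx)
  have hχR_temp : ∀ m, (χR m).HasTemperateGrowth := fun m =>
    (hχR_supp m).hasTemperateGrowth (hχR_smooth m)
  refine ⟨χR, hχR_temp, fun m => ?_, ?_⟩
  · refine (SchwartzMap.tsupport_smulLeftCLM_subset _ _).trans (Set.inter_subset_inter_right _ ?_)
    refine closure_minimal (fun x hx => ?_) isClosed_closedBall
    by_contra h
    exact hx (hχR_zero m x (by simpa [mem_closedBall_zero_iff] using h))
  -- uniform bounds on the derivatives of the bump and its rescalings
  have hM : ∀ i : ℕ, ∃ M : ℝ, ∀ y, ‖iteratedFDeriv ℝ i (χ : E → ℝ) y‖ ≤ M := fun i => by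
    obtain ⟨x₀, hx₀⟩ := ((hχ_smooth.continuous_iteratedFDeriv (m := i)
      (by exact_mod_cast le_top)).norm).exists_forall_ge_of_hasCompactSupport
      ((χ.hasCompactSupport.iteratedFDeriv i).norm)
    exact ⟨_, hx₀⟩
  choose M hM using hM
  have hM0 : ∀ i, 0 ≤ M i := fun i => (norm_nonneg _).trans (hM i 0)
  have hL1 : ∀ m, ‖L m‖ ≤ 1 := by
    intro m
    change ‖((m : ℝ) + 1)⁻¹ • ContinuousLinearMap.id ℝ E‖ ≤ 1
    refine (ContinuousLinearMap.opNorm_smul_le _ _).trans ?_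
    rw [norm_inv, Real.norm_of_nonneg (hR m).le]
    calc ((m : ℝ) + 1)⁻¹ * ‖ContinuousLinearMap.id ℝ E‖ ≤ 1 * 1 :=
          mul_le_mul (inv_le_one_of_one_le₀ (by linarith [(m.cast_nonneg : (0 : ℝ) ≤ m)]))
            ContinuousLinearMap.norm_id_le (norm_nonneg _) zero_le_one
      _ = 1 := one_mul 1
  have hDχR : ∀ m i x, ‖iteratedFDeriv ℝ i (χR m) x‖ ≤ M i := fun m i x =>
    (Literature.MathematicalPhysics.QuantumLattice.norm_iteratedFDeriv_comp_clm_le hχ_smooth (L m) (hL1 m) i x).trans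
      (hM i _)
  have hDψ : ∀ m i x, ‖iteratedFDeriv ℝ i (fun y => χR m y - 1) x‖ ≤ M i + 1 := by
    intro m i x
    have hsub : (fun y => χR m y - 1) = χR m - fun _ => (1 : ℝ) := rfl
    rw [hsub, iteratedFDeriv_sub_apply ((hχR_smooth m).of_le (by exact_mod_cast le_top)).contDiffAt
      contDiffAt_const]
    refine (norm_sub_le _ _).trans (add_le_add (hDχR m i x) ?_)
    rcases Nat.eq_zero_or_pos i with rfl | hi
    · rw [norm_iteratedFDeriv_zero]; simp
    · rw [iteratedFDeriv_const_of_ne (Nat.pos_iff_ne_zero.1 hi)]; simp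
  -- pointwise identification of `u m - f`
  have hcoe : ∀ m, (⇑(SchwartzMap.smulLeftCLM F (χR m) f - f) : E → F) =
      fun x => (χR m x - 1) • f x := by
    intro m
    funext x
    simp only [sub_apply, SchwartzMap.smulLeftCLM_apply_apply (hχR_temp m), sub_smul,
      one_smul]
  -- the seminorm estimate `p_{k,n}(u m - f) ≤ K / (m + 1)`
  have hest : ∀ k n : ℕ, ∃ K : ℝ, 0 ≤ K ∧ ∀ m : ℕ,
      SchwartzMap.seminorm ℝ k n (SchwartzMap.smulLeftCLM F (χR m) f - f) ≤ K / ((m : ℝ) + 1) := by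
    intro k n
    set S' := (Finset.Iic (k + 1, n)).sup (schwartzSeminormFamily ℝ E F) f with hS'
    have hS'0 : 0 ≤ S' := apply_nonneg _ _
    set K := (∑ i ∈ Finset.range (n + 1), (n.choose i : ℝ) * (M i + 1)) * S' with hK
    have hK0 : 0 ≤ K := by
      refine mul_nonneg (Finset.sum_nonneg fun i _ => ?_) hS'0
      have := hM0 i
      positivity
    refine ⟨K, hK0, fun m => ?_⟩
    refine SchwartzMap.seminorm_le_bound ℝ k n _ (by positivity) fun x => ?_
    rw [hcoe m]
    by_cases hx : ‖x‖ < (m : ℝ) + 1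
    · -- inside the ball the cutoff is `1`, so `u m - f` vanishes near `x`
      have hsupp : Function.support (fun y => (χR m y - 1) • f y) ⊆ (ball (0 : E) ((m : ℝ) + 1))ᶜ := by
        intro y hy
        rw [mem_compl_iff, mem_ball_zero_iff, not_lt]
        by_contra h
        push Not at h
        exact hy (by change (χR m y - 1) • f y = 0; rw [hχR_one m y h.le, sub_self, zero_smul])
      have hx' : x ∉ tsupport (fun y => (χR m y - 1) • f y) := fun h =>
        (closure_minimal hsupp isOpen_ball.isClosed_compl h) (mem_ball_zero_iff.2 hx)
      have h0 : iteratedFDeriv ℝ n (fun y => (χR m y - 1) • f y) x = 0 :=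
        Function.notMem_support.1 fun h => hx' (support_iteratedFDeriv_subset n h)
      rw [h0, norm_zero, mul_zero]
      positivity
    · push Not at hx
      have hxpos : 0 < ‖x‖ := (hR m).trans_le hx
      have hψ : ContDiff ℝ n (fun y => χR m y - 1) :=
        ((hχR_smooth m).sub contDiff_const).of_le (by exact_mod_cast le_top)
      have hleib := norm_iteratedFDeriv_smul_le (𝕜 := ℝ) hψ (f.smooth n) x (n := n) le_rfl
      have hterm : ∀ i ∈ Finset.range (n + 1),
          ‖x‖ ^ k * ((n.choose i : ℝ) * ‖iteratedFDeriv ℝ i (fun y => χR m y - 1) x‖ *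
            ‖iteratedFDeriv ℝ (n - i) f x‖) ≤ (n.choose i : ℝ) * (M i + 1) * (S' / ((m : ℝ) + 1)) := by
        intro i _
        have h1 : ‖x‖ ^ k * ‖iteratedFDeriv ℝ (n - i) f x‖ ≤ S' / ((m : ℝ) + 1) := by
          rw [le_div_iff₀ (hR m)]
          have h2 : ‖x‖ ^ (k + 1) * ‖iteratedFDeriv ℝ (n - i) f x‖ ≤ S' :=
            (SchwartzMap.le_seminorm ℝ (k + 1) (n - i) f x).trans
              (Seminorm.le_def.1 (Finset.le_sup (f := schwartzSeminormFamily ℝ E F)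
                (Finset.mem_Iic.2 (Prod.mk_le_mk.2 ⟨le_rfl, Nat.sub_le n i⟩))) f)
          calc ‖x‖ ^ k * ‖iteratedFDeriv ℝ (n - i) f x‖ * ((m : ℝ) + 1)
              ≤ ‖x‖ ^ k * ‖iteratedFDeriv ℝ (n - i) f x‖ * ‖x‖ := by gcongr
            _ = ‖x‖ ^ (k + 1) * ‖iteratedFDeriv ℝ (n - i) f x‖ := by ring
            _ ≤ S' := h2
        calc ‖x‖ ^ k * ((n.choose i : ℝ) * ‖iteratedFDeriv ℝ i (fun y => χR m y - 1) x‖ *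
              ‖iteratedFDeriv ℝ (n - i) f x‖)
            = (n.choose i : ℝ) * ‖iteratedFDeriv ℝ i (fun y => χR m y - 1) x‖ *
                (‖x‖ ^ k * ‖iteratedFDeriv ℝ (n - i) f x‖) := by ring
          _ ≤ (n.choose i : ℝ) * (M i + 1) * (S' / ((m : ℝ) + 1)) :=
              mul_le_mul (mul_le_mul_of_nonneg_left (hDψ m i x) (by positivity)) h1
                (by positivity) (by have := hM0 i; positivity)
      calc ‖x‖ ^ k * ‖iteratedFDeriv ℝ n (fun y => (χR m y - 1) • f y) x‖
          ≤ ‖x‖ ^ k * ∑ i ∈ Finset.range (n + 1), (n.choose i : ℝ) *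
              ‖iteratedFDeriv ℝ i (fun y => χR m y - 1) x‖ * ‖iteratedFDeriv ℝ (n - i) f x‖ := by
            gcongr
        _ = ∑ i ∈ Finset.range (n + 1), ‖x‖ ^ k * ((n.choose i : ℝ) *
              ‖iteratedFDeriv ℝ i (fun y => χR m y - 1) x‖ * ‖iteratedFDeriv ℝ (n - i) f x‖) := by
            rw [Finset.mul_sum]
        _ ≤ ∑ i ∈ Finset.range (n + 1), (n.choose i : ℝ) * (M i + 1) * (S' / ((m : ℝ) + 1)) :=
            Finset.sum_le_sum hterm
        _ = K / ((m : ℝ) + 1) := by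
            rw [hK, ← Finset.sum_mul]
            ring
  -- conclusion
  rw [(schwartz_withSeminorms ℝ E F).tendsto_nhds_atTop]
  rintro ⟨k, n⟩ ε hε
  obtain ⟨K, hK0, hK⟩ := hest k n
  refine ⟨⌈K / ε⌉₊, fun m hm => ?_⟩
  rw [SchwartzMap.schwartzSeminormFamily_apply]
  have hm' : K / ε < (m : ℝ) + 1 :=
    (Nat.le_ceil _).trans_lt (by exact_mod_cast Nat.lt_succ_of_le hm)
  calc SchwartzMap.seminorm ℝ k n (SchwartzMap.smulLeftCLM F (χR m) f - f) ≤ K / ((m : ℝ) + 1) :=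
        hK m
    _ < ε := by
        rw [div_lt_iff₀ (hR m)]
        rw [div_lt_iff₀ hε] at hm'
        linarith

end Cutoff

section OffDiagonal

open Literature.MathematicalPhysics.AQFT

variable {E : Type*} [NormedAddCommGroup E] [NormedSpace ℝ E] [FiniteDimensional ℝ E] {n : ℕ}

/-- Compact cutoffs inside `⁰𝒮` (binder form of `exists_offDiagonal_cutoff_tendsto`). -/
theorem exists_offDiagonal_cutoff_tendsto' (F : 𝓢((Fin n → E), ℂ)) (hF : IsOffDiagonal F) :
    ∃ u : ℕ → 𝓢((Fin n → E), ℂ),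
      (∀ m : ℕ, tsupport (u m : (Fin n → E) → ℂ) ⊆
        tsupport (F : (Fin n → E) → ℂ) ∩ closedBall (0 : Fin n → E) (2 * ((m : ℝ) + 1))) ∧
      (∀ m, IsOffDiagonal (u m)) ∧ Tendsto u atTop (𝓝 F) := by
  obtain ⟨ψ, hψ, hsupp, hlim⟩ := exists_smulLeftCLM_cutoff_tendsto F
  refine ⟨fun m => SchwartzMap.smulLeftCLM ℂ (ψ m) F, hsupp, fun m => ?_, hlim⟩
  have hψC : (fun x => RCLike.ofReal (K := ℂ) (ψ m x)).HasTemperateGrowth := by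
    have := hψ m
    fun_prop
  have h := Literature.MathematicalPhysics.QuantumLattice.isOffDiagonal_smulLeftCLM hψC hF
  rwa [SchwartzMap.smulLeftCLM_ofReal ℂ (hψ m) F] at h

end OffDiagonal

/-- **Compact cutoffs inside `⁰𝒮`.**  For `F ∈ ⁰𝒮(Eⁿ)` (all derivatives vanish on the coincidence locus) there are
compactly supported `u m ∈ ⁰𝒮(Eⁿ)` with `tsupport (u m) ⊆ tsupport F ∩ closedBall 0 (2 (m + 1))` and `u m → F` in
`𝓢` — the bump cutoffs of `exists_smulLeftCLM_cutoff_tendsto` and the module property `isOffDiagonal_smulLeftCLM`. -/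
theorem exists_offDiagonal_cutoff_tendsto : ∀ {E : Type*} [NormedAddCommGroup E] [NormedSpace ℝ E] [FiniteDimensional ℝ E] {n : ℕ} (F : SchwartzMap (Fin n → E) ℂ), Literature.MathematicalPhysics.AQFT.IsOffDiagonal F → ∃ u : ℕ → SchwartzMap (Fin n → E) ℂ, (∀ m : ℕ, tsupport (u m : (Fin n → E) → ℂ) ⊆ tsupport (F : (Fin n → E) → ℂ) ∩ Metric.closedBall (0 : Fin n → E) (2 * ((m : ℝ) + 1))) ∧ (∀ m, Literature.MathematicalPhysics.AQFT.IsOffDiagonal (u m)) ∧ Filter.Tendsto u Filter.atTop (nhds F) :=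
  fun F hF => exists_offDiagonal_cutoff_tendsto' F hF


end Summit.QuantumFields.YangMills.Theorems.OSLegsFromFemtoAndGap
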